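/-
Copyright (c) 2026 the pub-hodgecm-mathlib formalisation cell (harness21).  Prover seat hodgecm-mathlib-LH3-p02 (g3) on line LH3 (closer stub `stub_N9`, N9 «Transf» direct
road), organ J, brick (J-G′-SIDE) = LH3-plan (g3) RULINGS #6 (c) «(J-G′-JUMP) ownership ∕ final assembly»; 2026-09-02.
-/
import Literature.NumberTheory.Rogawski1990.ArchOrbFamGExtJumpOfBricks   -- ★ p850303 (LH3-p02 (g2)): the (J-G′-JUMP) shell `hasOneSidedJump_archERhoG_mul_orbFamGExt_of_bricks`; brings ★ docks (`orbFamGExt_insert_hcCayPt_eq_of_tendsto`), `orbFamGExt`, `orbFamG_apply`, `chartOrbG`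
import Literature.NumberTheory.Rogawski1990.ArchOrbFamGExtJumpWall       -- ★ p850367 (LH5-p03 (g2)): (c-wall) `exists_wallFactor_archERhoG_mul_archRG` (explicit `r`), `wallFactorLimit_ne_zero_of_hcSemireg`; brings ★ p850207 §4 `archRG_insert_eq_mul_prod_erase`, `archRG_insert_update_prod_erase`, `archERhoG_insert_update`
import Literature.NumberTheory.Rogawski1990.ArchCayleyValueOfMembership  -- ★ p850419 (LH4-p01 (g3)) (V1-G′) (ED. 2, §4): `tendsto_orbFamG_nhdsWithin_regG_hcCayPt`, `orbFamGExt_insert_hcCayPt_eq_of_tendsto_cayRay`, the `x`-ray `hcCayPt w i j p + x • e_{w,0}` (`tendsto_cayRay`, `cayRay_apply_self_zero`)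
import Literature.NumberTheory.Automorphic.ArchRankOneJumpZeroCone        -- ★ p850353 (F0P3a-p07 (g16)) (K0±-FORM-TRANSPORT) (ED. 3, §5): the standard rank-one group `U(J)`, `cayley_conj_circleDiagonal_mem_of_eq_over`, the Cayley half-cone token of the SHARED datum (RULINGS #8)
import HarnessLib

/-!
# (J-G′-SIDE): the `G′`-side jump brick (JG′) of organ J FROM NAMED BRICKS — the split-chart wall factor at the Cayley point, the Cayley value, and the jump∕value bookkeeping
# (Shelstad 1979 §4 Lemma 4.3, Prop. 4.5; Rogawski 1990 §8.2 pp. 119–124)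

Topic `NumberTheory/Rogawski1990`; namespace `Literature.NumberTheory.Rogawski1990`.  THEOREMS ONLY (no definition, no instance, no notation, no axiom, no named fact, no `sorry`);
kernel lane `--kind proof --supports stmt-HodgeConjecture-24833`.  Cell `pub/hodgecm-mathlib` (D-0151), crux H413 = `stmt-HodgeConjecture-24833`, F0∕P3c line LH3 (closer stub
`stub_N9`, DIRECT ROAD `F0_P3c_StubN9Direct`, organ J `JumpAgreementStatement`, composed over ★ p850355 (J-HEAD) `agreesOnAdmissibleCoveredSlots_of_bricks`).  This file delivers,
for ONE test function `a′`, the **(JG′) conjunct of (J-HEAD)'s `hbricks`** —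
`HasOneSidedJump (ν ↦ e^{ρ}_S(c_ν) · orbFamGExt ν′ a′ S c_ν) (cG · (e^{ρ}_{S∪w}(cay) · orbFamGExt ν′ a′ (S∪w) (cay))) ∧ orbFamGExt ν′ a′ (S∪w) (cay) ≠ 0`
(`c_ν = p + ν • hcNrm w 0 2`, `cay = hcCayPt w 0 2 p`) — from the named analytic bricks of the line, each entering BY STATEMENT exactly as its owner produces it:
(DESC) `hdesc` (the descent-to-block formula along the normal, (J-G′-BLOCK) F0P3-p02 (g18)); (K0) `hjump` (the rank-one block jump, ★ p850353 F0P3a-p07 (g16), instantiated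
by name at the block function); (CAY-LIM) `hlim` (the `|D_w|^{1∕2}`-normalised chart functional of the SPLIT chart `insert w S` has a `RegG`-limit `Λ` at the Cayley point —
(A0-c)∕(L-d) F0P3a-p05 (g19)∕F0P3b-p01 (g15) after the split-side block reduction); (NONDEG) `Λ ≠ 0`; (BOOK-G′) `cG · Λ = i · K · J_b`.  The wall-factor inputs are NOT binders:
the compact-chart factor `e^{ρ}·R′(c_ν) = 2 sin ν · R(ν)`, `R → r`, is ★ (c-wall) p850367, and the split-chart factor at the Cayley point is computed HERE (§1).

THE MATHEMATICS.  On the split chart `insert w S` write `R′_{S∪w}(c) = |e^{x_w} − e^{−x_w}| · C(c)` (§1: `C` = the two complex-pair root factors at `w` times the frozen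
factors of the other places; continuous in `c`).  At the Cayley point of a wall point `p` (`θ₀ = θ₂ =: θ`, `φ := θ₁`): `C(cay) = |e^{iθ} − e^{iφ}|² · ∏_{w′ ≠ w}(R′-factor at p)`,
and `e^{ρ}_{S∪w}(cay) = ∏_{w′ ≠ w, w′ ∉ S} e^{i(θ₀−θ₂)(w′)}` (no factor at the now-split place `w`), so that
**`i · e^{ρ}_{S∪w}(cay) · C(cay) = r`**, the limit of ★ (c-wall)'s `R` (whose `w`-factor is `i·|e^{iθ} − e^{iφ}|²`): the JUNCTION of the two wall factors (§1).  Hence, if the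
normalised split functional `|e^{x}−e^{−x}| · chartOrbG (S∪w) a′ c → Λ` along `RegG (S∪w) ∋ c → cay`, then `orbFamG (S∪w) c = C(c) · (|e^{x}−e^{−x}| · chartOrbG …) → C(cay)·Λ`,
which by the ★ dock IS the extended value `orbFamGExt ν′ a′ (S∪w) (cay)` (§2); and the ★ shell gives the jump `r · K · J_b` of `e^{ρ}_S · orbFamGExt … S` along the normal.  With
`cG · Λ = i·K·J_b`:  `r·K·J_b = i·e^{ρ}(cay)·C(cay)·K·J_b = e^{ρ}(cay)·C(cay)·(cG·Λ) = cG · (e^{ρ}(cay) · value)` — the (JG′) text, and `value = C(cay)·Λ ≠ 0` (§3).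
With the bricks' constants `J_b = C₁·cone`, `Λ = K_β·C₂·cone` (the SAME cone functional of the SAME descended block function on both charts) this reads `cG = i·K·C₁∕(K_β·C₂)` (§3, explicit form).

* §1 (group-free, `W` any finite index of places): `archRG_insert_eq_absSub_mul_splitCofactor`, `continuous_splitCofactor`, `archERhoG_insert_hcCayPt_eq`, `splitCofactor_hcCayPt_eq`,
  **`I_mul_archERhoG_insert_hcCayPt_mul_splitCofactor_eq`** (the junction with ★ p850367's `r`), `splitCofactor_hcCayPt_ne_zero`, and the package **`exists_splitCofactor_insert`**;
* §2 (genuine family): `insert_subset_splitChartPlaces`, **`tendsto_orbFamG_insert_hcCayPt_of_tendsto`**, **`orbFamGExt_insert_hcCayPt_eq_mul_of_tendsto`**;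
* §3 **`hasOneSidedJump_orbFamGExt_side_of_bricks`** (the (JG′) conjunct for one `a′`, constants abstract) and **`hasOneSidedJump_orbFamGExt_side_of_bricks_explicit`** (`cG = i·K·C₁∕(K_β·C₂)`);
* §4 (ED. 2, over ★ (V1-G′) `ArchCayleyValueOfMembership`): the full-neighbourhood binder `hlim` REPLACED by the membership's smooth clause `hsm` on the split chart + the one-variable
  `x`-ray limit `hray` — `tendsto_orbFamG_cayRay_of_tendsto`, `orbFamGExt_insert_hcCayPt_eq_mul_of_tendsto_cayRay`, **`tendsto_absSub_mul_chartOrbG_nhdsWithin_regG_of_tendsto_cayRay`**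
  (ray-to-full upgrade), **`hasOneSidedJump_orbFamGExt_side_of_bricks_of_cayRay`** (+ `_explicit`);
* §5 (ED. 3, (c-jump) over the SHARED rank-one datum of RULINGS #8): **`hasOneSidedJump_two_sin_mul_integral_block_of_sharedK0`** — §3's binder `hjump` for a block function on the
  standard group `U(J)` from the shared antecedent `hK0` (★ p850353's text for `(μ₀, C₁)`), jump in the (A0) cone token;
* §6 (ED. 3, the SHARED LITERAL of RULINGS #8 (ii)): `sharedLiteral_mul_eq`, `sharedLiteral_lambda_ne_zero`, **`hasOneSidedJump_orbFamGExt_side_of_bricks_std`** and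
  **`hasOneSidedJump_orbFamGExt_side_of_bricks_of_cayRay_std`** — jump constant LITERALLY `(I * C₁ / C₂ : ℂ)` (the `hG` token of ★ `jumpBricks_of_sides_std`) from
  `J_b = C₁·cone`, `Λ = K·(C₂·cone)`, `cone ≠ 0`, `K ≠ 0`, `C₂ ≠ 0` (one descent constant `K` on both charts: (G′-CANCEL)).
HONEST LABEL: HC_CM is proved only modulo the 7 printed citations (2 remaining: hLiu418 = `stmt-HodgeConjecture-24832`, h413 = `stmt-HodgeConjecture-24833`) until rung 0 closes;
count-neutral: an assembler — the analysis sits in `hdesc`, `hjump`, `hlim`, `Λ ≠ 0`, each a named brick of the line.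

## References
* [Shelstad1979] D. Shelstad, *Characters and inner forms of a quasi-split group over ℝ*, Compositio Math. 39 (1979), §4 pp. 22–25 (`R_T`, the Cayley transform at a noncompact
  wall, Lemma 4.3), Prop. 4.5 p. 26 (`d(α)`), Thm. 4.7 (IIIb) p. 31.
* [Rogawski1990] J. D. Rogawski, *Automorphic Representations of Unitary Groups in Three Variables*, Ann. of Math. Stud. 123 (1990), §8.2 pp. 118–124 (p. 119 Prop. 8.2.1 (c), p. 122
  the curve `(θ+ψ, θ₁, θ−ψ)` and `2i sin ψ`), §4.12 Lemma 4.12.1 p. 66.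
* [Bouaziz1994IntegralesOrbitales] A. Bouaziz, *Intégrales orbitales sur les groupes de Lie réductifs*, Ann. Sci. ÉNS 27 (1994), §3.2 (I₃) p. 580, Rem. 2 p. 594.
* [Varadarajan1977] V. S. Varadarajan, *Harmonic Analysis on Real Reductive Groups*, LNM 576 (1977), Part I §1.12 (extension of the normalised orbital integral to `T_{in-reg}`).
-/

set_option autoImplicit false

noncomputable section

open MeasureTheory MeasureTheory.Measure NumberField NumberField.InfinitePlace Matrix Complex Set Filter Topology
open scoped MatrixGroups Matrix Real Classical
open Literature.NumberTheory.Automorphic Literature.NumberTheory.Automorphic.UnitaryGroup Literature.NumberTheory.Automorphic.ArchCartan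
open Literature.NumberTheory.Automorphic.Shelstad1979.StableOrbitalIntegrals
open Literature.NumberTheory.GaloisRepresentations

namespace Literature.NumberTheory.Rogawski1990

/-! ## §1 The split-chart wall factor at the Cayley point (group-free) -/

section SplitWall

variable {W : Type*} [Fintype W] [DecidableEq W]

/-- **`R′_{S∪w}(c) = |e^{x_w} − e^{−x_w}| · C(c)`**: the split-chart normaliser splits off the REAL-ROOT factor of the place `w`; the cofactor `C(c)` is the complex-pair factor
`|e^{x+iθ} − e^{iφ}|·|e^{−x+iθ} − e^{iφ}|` at `w` times the frozen factors of the other places (★ `archRG_insert_eq_mul_prod_erase`, reassociated).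
[cite: Shelstad1979, §4 p. 22; Lemma 4.3 (p. 25)] [cite: Rogawski1990, §8.2 p. 118] -/
theorem archRG_insert_eq_absSub_mul_splitCofactor (S : Finset W) (w : W) (c : W → Fin 3 → ℝ) :
    archRG (insert w S) c =
      ((|Real.exp (c w 0) - Real.exp (-c w 0)| : ℝ) : ℂ) *
        (((‖Complex.exp (c w 0 + c w 2 * I) - Complex.exp (c w 1 * I)‖ * ‖Complex.exp (-c w 0 + c w 2 * I) - Complex.exp (c w 1 * I)‖ : ℝ) : ℂ) *
          ∏ w' ∈ Finset.univ.erase w,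
            (if w' ∈ insert w S then
                ((|Real.exp (c w' 0) - Real.exp (-c w' 0)| *
                  ‖Complex.exp (c w' 0 + c w' 2 * I) - Complex.exp (c w' 1 * I)‖ * ‖Complex.exp (-c w' 0 + c w' 2 * I) - Complex.exp (c w' 1 * I)‖ : ℝ) : ℂ)
              else (1 - (Circle.exp (c w' 1 - c w' 0) : ℂ)) * (1 - (Circle.exp (c w' 2 - c w' 0) : ℂ)) * (1 - (Circle.exp (c w' 2 - c w' 1) : ℂ)))) := by
  rw [archRG_insert_eq_mul_prod_erase, mul_assoc (|Real.exp (c w 0) - Real.exp (-c w 0)|), Complex.ofReal_mul, mul_assoc]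

/-- The cofactor `C(c)` of `R′_{S∪w}` is a CONTINUOUS function of the chart point `c` (norms of exponentials, absolute values, finite products). [cite: Shelstad1979, §4 p. 22] -/
theorem continuous_splitCofactor (S : Finset W) (w : W) :
    Continuous fun c : W → Fin 3 → ℝ =>
      ((‖Complex.exp (c w 0 + c w 2 * I) - Complex.exp (c w 1 * I)‖ * ‖Complex.exp (-c w 0 + c w 2 * I) - Complex.exp (c w 1 * I)‖ : ℝ) : ℂ) *
        ∏ w' ∈ Finset.univ.erase w,
          (if w' ∈ insert w S then
              ((|Real.exp (c w' 0) - Real.exp (-c w' 0)| *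
                ‖Complex.exp (c w' 0 + c w' 2 * I) - Complex.exp (c w' 1 * I)‖ * ‖Complex.exp (-c w' 0 + c w' 2 * I) - Complex.exp (c w' 1 * I)‖ : ℝ) : ℂ)
            else (1 - (Circle.exp (c w' 1 - c w' 0) : ℂ)) * (1 - (Circle.exp (c w' 2 - c w' 0) : ℂ)) * (1 - (Circle.exp (c w' 2 - c w' 1) : ℂ))) := by
  -- the coordinate projections and the three kinds of elementary factors are continuous
  have hco : ∀ (w' : W) (i : Fin 3), Continuous fun c : W → Fin 3 → ℝ => c w' i := fun w' i => (continuous_apply i).comp (continuous_apply w')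
  have hcoC : ∀ (w' : W) (i : Fin 3), Continuous fun c : W → Fin 3 → ℝ => ((c w' i : ℝ) : ℂ) := fun w' i => Complex.continuous_ofReal.comp (hco w' i)
  have hpair : ∀ w' : W, Continuous fun c : W → Fin 3 → ℝ =>
      ‖Complex.exp (c w' 0 + c w' 2 * I) - Complex.exp (c w' 1 * I)‖ * ‖Complex.exp (-c w' 0 + c w' 2 * I) - Complex.exp (c w' 1 * I)‖ := fun w' =>
    ((Complex.continuous_exp.comp ((hcoC w' 0).add ((hcoC w' 2).mul continuous_const))).sub
        (Complex.continuous_exp.comp ((hcoC w' 1).mul continuous_const))).norm.mul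
      ((Complex.continuous_exp.comp ((hcoC w' 0).neg.add ((hcoC w' 2).mul continuous_const))).sub
        (Complex.continuous_exp.comp ((hcoC w' 1).mul continuous_const))).norm
  have habs : ∀ w' : W, Continuous fun c : W → Fin 3 → ℝ => |Real.exp (c w' 0) - Real.exp (-c w' 0)| := fun w' =>
    ((Real.continuous_exp.comp (hco w' 0)).sub (Real.continuous_exp.comp (hco w' 0).neg)).abs
  have hcirc : ∀ (w' : W) (i j : Fin 3), Continuous fun c : W → Fin 3 → ℝ => (1 - (Circle.exp (c w' i - c w' j) : ℂ)) := fun w' i j =>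
    continuous_const.sub (continuous_subtype_val.comp (Circle.exp.continuous.comp ((hco w' i).sub (hco w' j))))
  refine (Complex.continuous_ofReal.comp (hpair w)).mul (continuous_finsetProd _ fun w' _ => ?_)
  by_cases hw' : w' ∈ insert w S
  · simp only [hw', if_true]
    exact Complex.continuous_ofReal.comp (((habs w').mul
      ((Complex.continuous_exp.comp ((hcoC w' 0).add ((hcoC w' 2).mul continuous_const))).sub
        (Complex.continuous_exp.comp ((hcoC w' 1).mul continuous_const))).norm).mul
      ((Complex.continuous_exp.comp ((hcoC w' 0).neg.add ((hcoC w' 2).mul continuous_const))).sub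
        (Complex.continuous_exp.comp ((hcoC w' 1).mul continuous_const))).norm)
  · simp only [hw', if_false]
    exact ((hcirc w' 1 0).mul (hcirc w' 2 0)).mul (hcirc w' 2 1)

/-- **`e^{ρ}_{S∪w}` AT THE CAYLEY POINT**: the place `w` is now split (factor `1`), the other places are frozen at `p` — `archERhoG (insert w S) (hcCayPt w 0 2 p) = ∏_{w′ ≠ w}
(if w′ ∈ S then 1 else e^{i(p w′ 0 − p w′ 2)})` (★ `archERhoG_insert_update`). [cite: Shelstad1979, §4 p. 24; Lemma 4.3 (p. 25)] -/
theorem archERhoG_insert_hcCayPt_eq (S : Finset W) (w : W) (p : W → Fin 3 → ℝ) :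
    archERhoG (insert w S) (hcCayPt w 0 2 p) = ∏ w' ∈ Finset.univ.erase w, (if w' ∈ S then (1 : ℂ) else (Circle.exp (p w' 0 - p w' 2) : ℂ)) := by
  rw [hcCayPt, archERhoG_insert_update]
  unfold archERhoG
  rw [← Finset.mul_prod_erase Finset.univ _ (Finset.mem_univ w), if_pos (Finset.mem_insert_self w S), one_mul]
  refine Finset.prod_congr rfl fun w' hw' => ?_
  have hne : w' ≠ w := Finset.ne_of_mem_erase hw'
  by_cases hS : w' ∈ S
  · rw [if_pos (Finset.mem_insert_of_mem hS), if_pos hS]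
  · rw [if_neg (fun h => (Finset.mem_insert.1 h).elim hne hS), if_neg hS]

/-- **THE COFACTOR AT THE CAYLEY POINT OF A WALL POINT** (`p w 0 = p w 2 =: θ`, `φ := p w 1`; `cay = update p w (0, φ, θ)`): `C(cay) = |e^{iθ} − e^{iφ}|² · ∏_{w′ ≠ w}
(R′-factor of the chart `S` at `p w′`)` — the `x = 0` value of the complex-pair factor (★ `tendsto_splitWallFactor_nhds_zero`'s limit) times the frozen factors.
[cite: Shelstad1979, Lemma 4.3 (p. 25)] [cite: Rogawski1990, §8.2 p. 119] -/
theorem splitCofactor_hcCayPt_eq (S : Finset W) {w : W} {p : W → Fin 3 → ℝ} (hp : p w 0 = p w 2) :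
    ((‖Complex.exp (hcCayPt w 0 2 p w 0 + hcCayPt w 0 2 p w 2 * I) - Complex.exp (hcCayPt w 0 2 p w 1 * I)‖ *
          ‖Complex.exp (-hcCayPt w 0 2 p w 0 + hcCayPt w 0 2 p w 2 * I) - Complex.exp (hcCayPt w 0 2 p w 1 * I)‖ : ℝ) : ℂ) *
        ∏ w' ∈ Finset.univ.erase w,
          (if w' ∈ insert w S then
              ((|Real.exp (hcCayPt w 0 2 p w' 0) - Real.exp (-hcCayPt w 0 2 p w' 0)| *
                ‖Complex.exp (hcCayPt w 0 2 p w' 0 + hcCayPt w 0 2 p w' 2 * I) - Complex.exp (hcCayPt w 0 2 p w' 1 * I)‖ *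
                  ‖Complex.exp (-hcCayPt w 0 2 p w' 0 + hcCayPt w 0 2 p w' 2 * I) - Complex.exp (hcCayPt w 0 2 p w' 1 * I)‖ : ℝ) : ℂ)
            else (1 - (Circle.exp (hcCayPt w 0 2 p w' 1 - hcCayPt w 0 2 p w' 0) : ℂ)) * (1 - (Circle.exp (hcCayPt w 0 2 p w' 2 - hcCayPt w 0 2 p w' 0) : ℂ)) *
              (1 - (Circle.exp (hcCayPt w 0 2 p w' 2 - hcCayPt w 0 2 p w' 1) : ℂ))) =
      (((‖(Circle.exp (p w 0) : ℂ) - Circle.exp (p w 1)‖ ^ 2 : ℝ)) : ℂ) *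
        ∏ w' ∈ Finset.univ.erase w,
          (if w' ∈ S then
              ((|Real.exp (p w' 0) - Real.exp (-p w' 0)| *
                ‖Complex.exp (p w' 0 + p w' 2 * I) - Complex.exp (p w' 1 * I)‖ * ‖Complex.exp (-p w' 0 + p w' 2 * I) - Complex.exp (p w' 1 * I)‖ : ℝ) : ℂ)
            else (1 - (Circle.exp (p w' 1 - p w' 0) : ℂ)) * (1 - (Circle.exp (p w' 2 - p w' 0) : ℂ)) * (1 - (Circle.exp (p w' 2 - p w' 1) : ℂ))) := by
  have hc : hcCayPt w 0 2 p = Function.update p w ![0, p w 1, p w 0] := by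
    rw [hcCayPt_eq_of_wall hp, hcThird_zero_two]
  rw [hc, archRG_insert_update_prod_erase S w p _]
  congr 1
  · -- the complex-pair factor at `x = 0`
    simp only [Function.update_self, Matrix.cons_val_zero, Matrix.cons_val_one, Matrix.cons_val_two, Matrix.tail_cons, Matrix.head_cons,
      Complex.ofReal_zero, neg_zero, zero_add, Circle.coe_exp, ← pow_two]
  · refine Finset.prod_congr rfl fun w' hw' => ?_
    have hne : w' ≠ w := Finset.ne_of_mem_erase hw'
    by_cases hS : w' ∈ S
    · rw [if_pos (Finset.mem_insert_of_mem hS), if_pos hS]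
    · rw [if_neg (fun h => (Finset.mem_insert.1 h).elim hne hS), if_neg hS]

/-- **THE JUNCTION OF THE TWO WALL FACTORS: `i · e^{ρ}_{S∪w}(cay) · C(cay) = r`**, `r` = the limit of ★ (c-wall)'s `R` along the normal on the compact chart (★ p850367
`exists_wallFactor_archERhoG_mul_archRG`'s explicit third conjunct): both sides are `i·|e^{iθ} − e^{iφ}|² · ∏_{w′ ≠ w}(e^{ρ}-factor · R′-factor at p)`.  This identity is what makes
the jump∕Cayley-value ratio of the genuine family free of every normaliser. [cite: Shelstad1979, Lemma 4.3 (p. 25); Prop. 4.5 (p. 26)] [cite: Rogawski1990, §8.2 pp. 119, 122] -/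
theorem I_mul_archERhoG_insert_hcCayPt_mul_splitCofactor_eq (S : Finset W) {w : W} {p : W → Fin 3 → ℝ} (hp : p w 0 = p w 2) :
    I * (archERhoG (insert w S) (hcCayPt w 0 2 p) *
        (((‖Complex.exp (hcCayPt w 0 2 p w 0 + hcCayPt w 0 2 p w 2 * I) - Complex.exp (hcCayPt w 0 2 p w 1 * I)‖ *
              ‖Complex.exp (-hcCayPt w 0 2 p w 0 + hcCayPt w 0 2 p w 2 * I) - Complex.exp (hcCayPt w 0 2 p w 1 * I)‖ : ℝ) : ℂ) *
          ∏ w' ∈ Finset.univ.erase w,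
            (if w' ∈ insert w S then
                ((|Real.exp (hcCayPt w 0 2 p w' 0) - Real.exp (-hcCayPt w 0 2 p w' 0)| *
                  ‖Complex.exp (hcCayPt w 0 2 p w' 0 + hcCayPt w 0 2 p w' 2 * I) - Complex.exp (hcCayPt w 0 2 p w' 1 * I)‖ *
                    ‖Complex.exp (-hcCayPt w 0 2 p w' 0 + hcCayPt w 0 2 p w' 2 * I) - Complex.exp (hcCayPt w 0 2 p w' 1 * I)‖ : ℝ) : ℂ)
              else (1 - (Circle.exp (hcCayPt w 0 2 p w' 1 - hcCayPt w 0 2 p w' 0) : ℂ)) * (1 - (Circle.exp (hcCayPt w 0 2 p w' 2 - hcCayPt w 0 2 p w' 0) : ℂ)) *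
                (1 - (Circle.exp (hcCayPt w 0 2 p w' 2 - hcCayPt w 0 2 p w' 1) : ℂ))))) =
      I * (((‖(Circle.exp (p w 0) : ℂ) - Circle.exp (p w 1)‖ ^ 2 : ℝ)) : ℂ) *
        ∏ w' ∈ Finset.univ.erase w,
          ((if w' ∈ S then (1 : ℂ) else (Circle.exp (p w' 0 - p w' 2) : ℂ)) *
            (if w' ∈ S then
                ((|Real.exp (p w' 0) - Real.exp (-p w' 0)| *
                  ‖Complex.exp (p w' 0 + p w' 2 * I) - Complex.exp (p w' 1 * I)‖ * ‖Complex.exp (-p w' 0 + p w' 2 * I) - Complex.exp (p w' 1 * I)‖ : ℝ) : ℂ)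
              else (1 - (Circle.exp (p w' 1 - p w' 0) : ℂ)) * (1 - (Circle.exp (p w' 2 - p w' 0) : ℂ)) * (1 - (Circle.exp (p w' 2 - p w' 1) : ℂ)))) := by
  rw [splitCofactor_hcCayPt_eq S hp, archERhoG_insert_hcCayPt_eq, Finset.prod_mul_distrib]
  ring

/-- **`C(cay) ≠ 0` AT A SEMIREGULAR WALL POINT** (`e^{iφ} ≠ e^{iθ}` and `G′`-regularity at the other places: ★ `wallFactorLimit_ne_zero_of_hcSemireg` through the junction).
[cite: Shelstad1979, §4 p. 22; Prop. 4.5 (p. 26)] -/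
theorem splitCofactor_hcCayPt_ne_zero (S : Finset W) {w : W} {p : W → Fin 3 → ℝ} (hp : HcSemireg S w 0 2 p) :
    ((‖Complex.exp (hcCayPt w 0 2 p w 0 + hcCayPt w 0 2 p w 2 * I) - Complex.exp (hcCayPt w 0 2 p w 1 * I)‖ *
          ‖Complex.exp (-hcCayPt w 0 2 p w 0 + hcCayPt w 0 2 p w 2 * I) - Complex.exp (hcCayPt w 0 2 p w 1 * I)‖ : ℝ) : ℂ) *
        ∏ w' ∈ Finset.univ.erase w,
          (if w' ∈ insert w S then
              ((|Real.exp (hcCayPt w 0 2 p w' 0) - Real.exp (-hcCayPt w 0 2 p w' 0)| *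
                ‖Complex.exp (hcCayPt w 0 2 p w' 0 + hcCayPt w 0 2 p w' 2 * I) - Complex.exp (hcCayPt w 0 2 p w' 1 * I)‖ *
                  ‖Complex.exp (-hcCayPt w 0 2 p w' 0 + hcCayPt w 0 2 p w' 2 * I) - Complex.exp (hcCayPt w 0 2 p w' 1 * I)‖ : ℝ) : ℂ)
            else (1 - (Circle.exp (hcCayPt w 0 2 p w' 1 - hcCayPt w 0 2 p w' 0) : ℂ)) * (1 - (Circle.exp (hcCayPt w 0 2 p w' 2 - hcCayPt w 0 2 p w' 0) : ℂ)) *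
              (1 - (Circle.exp (hcCayPt w 0 2 p w' 2 - hcCayPt w 0 2 p w' 1) : ℂ))) ≠ 0 := by
  intro h
  have hr := wallFactorLimit_ne_zero_of_hcSemireg S hp
  rw [← I_mul_archERhoG_insert_hcCayPt_mul_splitCofactor_eq S hp.1, h, mul_zero, mul_zero] at hr
  exact hr rfl

/-- **THE SPLIT-CHART WALL FACTOR, PACKAGED** (the four facts the (JG′) assembly uses, with the cofactor abstracted): at a semiregular point `p` of the wall `(w, 0, 2)` there
is a continuous `C` with `R′_{S∪w}(c) = |e^{x_w} − e^{−x_w}| · C(c)` for every `c`, `i · e^{ρ}_{S∪w}(cay) · C(cay) = r` (★ p850367's explicit `r`) and `C(cay) ≠ 0`.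
[cite: Shelstad1979, Lemma 4.3 (p. 25); Prop. 4.5 (p. 26)] [cite: Rogawski1990, §8.2 pp. 119, 122] -/
theorem exists_splitCofactor_insert (S : Finset W) {w : W} {p : W → Fin 3 → ℝ} (hp : HcSemireg S w 0 2 p) :
    ∃ C : (W → Fin 3 → ℝ) → ℂ, Continuous C ∧
      (∀ c, archRG (insert w S) c = ((|Real.exp (c w 0) - Real.exp (-c w 0)| : ℝ) : ℂ) * C c) ∧
      I * (archERhoG (insert w S) (hcCayPt w 0 2 p) * C (hcCayPt w 0 2 p)) =
        I * (((‖(Circle.exp (p w 0) : ℂ) - Circle.exp (p w 1)‖ ^ 2 : ℝ)) : ℂ) *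
          ∏ w' ∈ Finset.univ.erase w,
            ((if w' ∈ S then (1 : ℂ) else (Circle.exp (p w' 0 - p w' 2) : ℂ)) *
              (if w' ∈ S then
                  ((|Real.exp (p w' 0) - Real.exp (-p w' 0)| *
                    ‖Complex.exp (p w' 0 + p w' 2 * I) - Complex.exp (p w' 1 * I)‖ * ‖Complex.exp (-p w' 0 + p w' 2 * I) - Complex.exp (p w' 1 * I)‖ : ℝ) : ℂ)
                else (1 - (Circle.exp (p w' 1 - p w' 0) : ℂ)) * (1 - (Circle.exp (p w' 2 - p w' 0) : ℂ)) * (1 - (Circle.exp (p w' 2 - p w' 1) : ℂ)))) ∧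
      C (hcCayPt w 0 2 p) ≠ 0 :=
  ⟨_, continuous_splitCofactor S w, archRG_insert_eq_absSub_mul_splitCofactor S w, I_mul_archERhoG_insert_hcCayPt_mul_splitCofactor_eq S hp.1,
    splitCofactor_hcCayPt_ne_zero S hp⟩

end SplitWall

/-! ## §2 The Cayley value of the extended genuine family from the normalised split-chart limit -/

section Admissible

variable (L : Type) [Field L] (α : Fin 3 → L) {S : Finset {w : InfinitePlace L // IsComplex w}} {w : {w : InfinitePlace L // IsComplex w}}

/-- At a covered place (`w` a split-chart place) the split chart `insert w S` of an admissible `S` is admissible. [cite: Rogawski1990, §3.6 p. 31; §8.2 p. 119] -/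
theorem insert_subset_splitChartPlaces (hS : ∀ v, v ∈ S → v ∈ splitChartPlaces L α) (hwsp : w ∈ splitChartPlaces L α) :
    ∀ v, v ∈ insert w S → v ∈ splitChartPlaces L α := fun v hv =>
  (Finset.mem_insert.1 hv).elim (fun h => h ▸ hwsp) (hS v)

end Admissible

section Genuine

variable (L : Type) [Field L] [NumberField L] [IsCMField L] (α : Fin 3 → L)
  [MeasurableSpace ↥(arch (↥(maximalRealSubfield L)) L (IsCMField.complexConj L) 3 (Matrix.diagonal α))] [BorelSpace ↥(arch (↥(maximalRealSubfield L)) L (IsCMField.complexConj L) 3 (Matrix.diagonal α))]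
  (ν' : Measure ↥(arch (↥(maximalRealSubfield L)) L (IsCMField.complexConj L) 3 (Matrix.diagonal α))) [IsFiniteMeasureOnCompacts ν'] [ν'.IsMulRightInvariant]
  (a' : ↥(arch (↥(maximalRealSubfield L)) L (IsCMField.complexConj L) 3 (Matrix.diagonal α)) → ℂ)
  {S : Finset {w : InfinitePlace L // IsComplex w}} (hS : ∀ v, v ∈ S → v ∈ splitChartPlaces L α)
  {w : {w : InfinitePlace L // IsComplex w}} (hwsp : w ∈ splitChartPlaces L α)
  {p : {w : InfinitePlace L // IsComplex w} → Fin 3 → ℝ}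

include hS hwsp in
/-- **THE RAW SPLIT-CHART MEMBER TENDS TO `C(cay) · Λ` AT THE CAYLEY POINT** if the `|D_w|^{1∕2}`-normalised chart functional tends to `Λ` there: on the admissible label
`insert w S`, `orbFamG (S∪w) c = R′_{S∪w}(c) · chartOrbG (S∪w) a′ c = C(c) · (|e^{x_w} − e^{−x_w}| · chartOrbG (S∪w) a′ c)` with `C` continuous (§1).
[cite: Shelstad1979, §4 p. 22; Lemma 4.3 (p. 25)] [cite: Varadarajan1977, I §1.12] -/
theorem tendsto_orbFamG_insert_hcCayPt_of_tendsto {C : ({w : InfinitePlace L // IsComplex w} → Fin 3 → ℝ) → ℂ} (hC : Continuous C)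
    (hfac : ∀ c, archRG (insert w S) c = ((|Real.exp (c w 0) - Real.exp (-c w 0)| : ℝ) : ℂ) * C c) {Λ : ℂ}
    (hlim : Tendsto (fun c => ((|Real.exp (c w 0) - Real.exp (-c w 0)| : ℝ) : ℂ) * chartOrbG L α ν' (insert w S) a' c)
      (𝓝[RegG (insert w S)] (hcCayPt w 0 2 p)) (𝓝 Λ)) :
    Tendsto (orbFamG L α ν' a' (insert w S)) (𝓝[RegG (insert w S)] (hcCayPt w 0 2 p)) (𝓝 (C (hcCayPt w 0 2 p) * Λ)) := by
  have hadm := insert_subset_splitChartPlaces L α hS hwsp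
  have hCt : Tendsto C (𝓝[RegG (insert w S)] (hcCayPt w 0 2 p)) (𝓝 (C (hcCayPt w 0 2 p))) :=
    (hC.tendsto _).mono_left nhdsWithin_le_nhds
  refine (hCt.mul hlim).congr' (Eventually.of_forall fun c => ?_)
  show C c * (((|Real.exp (c w 0) - Real.exp (-c w 0)| : ℝ) : ℂ) * chartOrbG L α ν' (insert w S) a' c) = orbFamG L α ν' a' (insert w S) c
  rw [orbFamG_apply L α ν' a' hadm, hfac c]
  ring

include hS hwsp in
/-- **THE CAYLEY VALUE OF THE EXTENDED GENUINE FAMILY**: at the Cayley point of a semiregular wall point, `orbFamGExt ν′ a′ (S∪w) (cay) = C(cay) · Λ` — the ★ dock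
`orbFamGExt_insert_hcCayPt_eq_of_tendsto` applied to the limit of `tendsto_orbFamG_insert_hcCayPt_of_tendsto` (the extension reads the `RegG`-limit of the raw member).
[cite: Varadarajan1977, I §1.12] [cite: Shelstad1979, Lemma 4.3 (p. 25)] [cite: Bouaziz1994IntegralesOrbitales, §3.1 (I₂) p. 579] -/
theorem orbFamGExt_insert_hcCayPt_eq_mul_of_tendsto (hp : HcSemireg S w 0 2 p) {C : ({w : InfinitePlace L // IsComplex w} → Fin 3 → ℝ) → ℂ} (hC : Continuous C)
    (hfac : ∀ c, archRG (insert w S) c = ((|Real.exp (c w 0) - Real.exp (-c w 0)| : ℝ) : ℂ) * C c) {Λ : ℂ}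
    (hlim : Tendsto (fun c => ((|Real.exp (c w 0) - Real.exp (-c w 0)| : ℝ) : ℂ) * chartOrbG L α ν' (insert w S) a' c)
      (𝓝[RegG (insert w S)] (hcCayPt w 0 2 p)) (𝓝 Λ)) :
    orbFamGExt L α ν' a' (insert w S) (hcCayPt w 0 2 p) = C (hcCayPt w 0 2 p) * Λ :=
  orbFamGExt_insert_hcCayPt_eq_of_tendsto L α ν' a' hp (tendsto_orbFamG_insert_hcCayPt_of_tendsto L α ν' a' hS hwsp hC hfac hlim)

end Genuine

/-! ## §3 The (JG′) conjunct of organ J for one test function, from the bricks -/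

section Side

variable (L : Type) [Field L] [NumberField L] [IsCMField L] (α : Fin 3 → L)
  [MeasurableSpace ↥(arch (↥(maximalRealSubfield L)) L (IsCMField.complexConj L) 3 (Matrix.diagonal α))] [BorelSpace ↥(arch (↥(maximalRealSubfield L)) L (IsCMField.complexConj L) 3 (Matrix.diagonal α))]
  (ν' : Measure ↥(arch (↥(maximalRealSubfield L)) L (IsCMField.complexConj L) 3 (Matrix.diagonal α))) [IsFiniteMeasureOnCompacts ν'] [ν'.IsMulRightInvariant]
  (a' : ↥(arch (↥(maximalRealSubfield L)) L (IsCMField.complexConj L) 3 (Matrix.diagonal α)) → ℂ)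
  {S : Finset {w : InfinitePlace L // IsComplex w}} (hS : ∀ v, v ∈ S → v ∈ splitChartPlaces L α)
  {w : {w : InfinitePlace L // IsComplex w}} (hw : w ∉ S) (hwsp : w ∈ splitChartPlaces L α)
  {p : {w : InfinitePlace L // IsComplex w} → Fin 3 → ℝ} (hp : HcSemireg S w 0 2 p)
  -- (DESC): the descent-to-block formula along the normal, for small `ν ≠ 0` ((J-G′-BLOCK), F0P3-p02 (g18))
  {K : ℂ} {Φ : ℝ → ℂ} (hdesc : ∀ᶠ ν in 𝓝[≠] (0 : ℝ), chartOrbG L α ν' S a' (p + ν • hcNrm w 0 2) = K * Φ ν)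
  -- (K0): the rank-one jump of the block orbital integral (★ p850353, instantiated at the block function)
  {Jb : ℂ} (hjump : HasOneSidedJump (fun ν : ℝ => (2 * Real.sin ν : ℂ) * Φ ν) Jb)
  -- (CAY-LIM): the `|D_w|^{1∕2}`-normalised split-chart functional has a `RegG`-limit at the Cayley point ((A0-c)∕(L-d) after the split-side block reduction)
  {Λ : ℂ} (hlim : Tendsto (fun c => ((|Real.exp (c w 0) - Real.exp (-c w 0)| : ℝ) : ℂ) * chartOrbG L α ν' (insert w S) a' c)
    (𝓝[RegG (insert w S)] (hcCayPt w 0 2 p)) (𝓝 Λ))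

include hS hw hwsp hp hdesc hjump hlim in
/-- **(JG′) FOR ONE TEST FUNCTION, FROM THE BRICKS.**  At a semiregular point `p` of the covered wall `(w, 0, 2)` of the admissible chart `S` (`w ∉ S` a split-chart place):
from (DESC) `chartOrbG S a′ (c_ν) = K·Φ(ν)` for small `ν ≠ 0`, (K0) `2 sin ν · Φ(ν)` jumps by `J_b`, (CAY-LIM) `|e^{x_w}−e^{−x_w}| · chartOrbG (S∪w) a′ → Λ` along
`RegG (S∪w) → cay`, (NONDEG) `Λ ≠ 0` and (BOOK-G′) `cG · Λ = i·K·J_b`:  the twisted extended member `ν ↦ e^{ρ}_S(c_ν) · orbFamGExt ν′ a′ S (c_ν)` jumps at `ν = 0` by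
`cG · (e^{ρ}_{S∪w}(cay) · orbFamGExt ν′ a′ (S∪w) (cay))`, and that Cayley value is non-zero — LITERALLY the (JG′) conjunct of ★ `agreesOnAdmissibleCoveredSlots_of_bricks`'s
`hbricks` for this `a′`.  Proof: ★ shell (jump `r·K·J_b`, (c-wall) ★ p850367) + §1 junction `r = i·e^{ρ}(cay)·C(cay)` + §2 value `C(cay)·Λ`.
[cite: Shelstad1979, Prop. 4.5 (p. 26); Thm. 4.7 (IIIb) (p. 31)] [cite: Rogawski1990, §8.2 pp. 119–124] [cite: Bouaziz1994IntegralesOrbitales, §3.2 (I₃) p. 580] -/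
theorem hasOneSidedJump_orbFamGExt_side_of_bricks (hΛ : Λ ≠ 0) {cG : ℂ} (hcG : cG * Λ = I * (K * Jb)) :
    HasOneSidedJump (fun ν : ℝ => archERhoG S (p + ν • hcNrm w 0 2) * orbFamGExt L α ν' a' S (p + ν • hcNrm w 0 2))
        (cG * (archERhoG (insert w S) (hcCayPt w 0 2 p) * orbFamGExt L α ν' a' (insert w S) (hcCayPt w 0 2 p))) ∧
      orbFamGExt L α ν' a' (insert w S) (hcCayPt w 0 2 p) ≠ 0 := by
  -- the compact-chart wall factor along the normal ((c-wall) ★ p850367), with `r` explicit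
  obtain ⟨R, r, hR, hwall, hr⟩ := exists_wallFactor_archERhoG_mul_archRG S hw hp.1
  -- the split-chart wall factor at the Cayley point (§1), cofactor abstracted
  obtain ⟨C, hC, hfac, hjunc, hC0⟩ := exists_splitCofactor_insert S hp
  -- the junction: `r = i · e^{ρ}_{S∪w}(cay) · C(cay)`
  have hrI : r = I * (archERhoG (insert w S) (hcCayPt w 0 2 p) * C (hcCayPt w 0 2 p)) := hr.trans hjunc.symm
  -- the shell: jump `r · K · J_b`
  have hJ := hasOneSidedJump_archERhoG_mul_orbFamGExt_of_bricks L α ν' a' hS hw hp hdesc hjump hwall hR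
  -- the Cayley value: `C(cay) · Λ`
  have hval : orbFamGExt L α ν' a' (insert w S) (hcCayPt w 0 2 p) = C (hcCayPt w 0 2 p) * Λ :=
    orbFamGExt_insert_hcCayPt_eq_mul_of_tendsto L α ν' a' hS hwsp hp hC hfac hlim
  refine ⟨?_, ?_⟩
  · have heq : r * K * Jb = cG * (archERhoG (insert w S) (hcCayPt w 0 2 p) * orbFamGExt L α ν' a' (insert w S) (hcCayPt w 0 2 p)) := by
      rw [hval, hrI]
      linear_combination (-(archERhoG (insert w S) (hcCayPt w 0 2 p) * C (hcCayPt w 0 2 p))) * hcG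
    rw [← heq]
    exact hJ
  · rw [hval]
    exact mul_ne_zero hC0 hΛ

include hS hw hwsp hp hdesc hjump hlim in
/-- **(JG′) FOR ONE TEST FUNCTION, EXPLICIT CONSTANT.**  With the bricks' constants written out — (K0) `J_b = C₁ · cone` (★ p850353: `C₁(ν_B) > 0` and the Cayley half-cone
functional of the descended block function), (CAY-LIM) `Λ = K_β · (C₂ · cone)` (the split-side descent constant and (A0-c)'s `C₂ > 0`, the SAME cone value), `cone ≠ 0`
((NONDEG-G′)), `K_β ≠ 0`, `C₂ ≠ 0` — the jump constant is **`cG = i · K · C₁ ∕ (K_β · C₂)`**: free of the test function, of the wall point and of every normaliser.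
[cite: Shelstad1979, Prop. 4.5 (p. 26); Thm. 4.7 (IIIb) (p. 31)] [cite: Rogawski1990, §8.2 Prop. 8.2.1 (c) p. 119; p. 122] -/
theorem hasOneSidedJump_orbFamGExt_side_of_bricks_explicit {C₁ C₂ Kβ cone : ℂ} (hJb : Jb = C₁ * cone) (hΛ : Λ = Kβ * (C₂ * cone))
    (hcone : cone ≠ 0) (hKβ : Kβ ≠ 0) (hC₂ : C₂ ≠ 0) :
    HasOneSidedJump (fun ν : ℝ => archERhoG S (p + ν • hcNrm w 0 2) * orbFamGExt L α ν' a' S (p + ν • hcNrm w 0 2))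
        ((I * (K * C₁) / (Kβ * C₂)) * (archERhoG (insert w S) (hcCayPt w 0 2 p) * orbFamGExt L α ν' a' (insert w S) (hcCayPt w 0 2 p))) ∧
      orbFamGExt L α ν' a' (insert w S) (hcCayPt w 0 2 p) ≠ 0 := by
  refine hasOneSidedJump_orbFamGExt_side_of_bricks L α ν' a' hS hw hwsp hp hdesc hjump hlim ?_ ?_
  · rw [hΛ]
    exact mul_ne_zero hKβ (mul_ne_zero hC₂ hcone)
  · rw [hΛ, hJb]
    field_simp

end Side

/-! ## §4 (ED. 2) (JG′) READ BY CONTINUITY: the membership's smooth clause and the ONE-VARIABLE `x`-ray limit replace the full `RegG`-limit `hlim`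

LH3-plan (g3) RULINGS #7 (2026-09-02T08:03:50Z ∕ 08:05:31Z): the residual `JumpBricksStatement` carries the membership `hHC`, whose clause (I₁)+(I₂) on the split chart
(`ContDiffOn ℝ ∞ (orbFamGExt ν′ a′ (S∪w)) (InRegG (slotSign α) (S∪w))`, the joiner's antecedent `hsm a′ ha′ |>.1`) makes `orbFamGExt ν′ a′ (S∪w)` CONTINUOUS AT the Cayley point
(★ (V1-G′) `ArchCayleyValueOfMembership`, LH4-p01 (g3): `tendsto_orbFamG_nhdsWithin_regG_hcCayPt`, the `x`-ray `cay + x • e_{w,0}` and `orbFamGExt_insert_hcCayPt_eq_of_tendsto_cayRay`).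
So the FULL `𝓝[RegG (S∪w)]`-limit of §3's binder `hlim` EXISTS for free, and its value is pinned by the limit along the single ray `x → 0⁺` with every other coordinate frozen at the
Cayley point — which is what (A0-c) ★ p850302∕p850345 (fixed block function, fixed `θ`) computes after the split-side block reduction ((V2), F0P3b-p01 (g15)). -/

section Ray

open scoped ContDiff

variable (L : Type) [Field L] [NumberField L] [IsCMField L] (α : Fin 3 → L)
  [MeasurableSpace ↥(arch (↥(maximalRealSubfield L)) L (IsCMField.complexConj L) 3 (Matrix.diagonal α))] [BorelSpace ↥(arch (↥(maximalRealSubfield L)) L (IsCMField.complexConj L) 3 (Matrix.diagonal α))]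
  (ν' : Measure ↥(arch (↥(maximalRealSubfield L)) L (IsCMField.complexConj L) 3 (Matrix.diagonal α))) [IsFiniteMeasureOnCompacts ν'] [ν'.IsMulRightInvariant]
  (a' : ↥(arch (↥(maximalRealSubfield L)) L (IsCMField.complexConj L) 3 (Matrix.diagonal α)) → ℂ)
  {S : Finset {w : InfinitePlace L // IsComplex w}} (hS : ∀ v, v ∈ S → v ∈ splitChartPlaces L α)
  {w : {w : InfinitePlace L // IsComplex w}} (hwsp : w ∈ splitChartPlaces L α)
  {p : {w : InfinitePlace L // IsComplex w} → Fin 3 → ℝ} (hp : HcSemireg S w 0 2 p)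
  -- (I₁)+(I₂) on the split chart: the joiner's antecedent `hsm a′ ha′ |>.1` (RULINGS #7)
  (hsm : ContDiffOn ℝ ∞ (orbFamGExt L α ν' a' (insert w S)) (InRegG (slotSign L α) (insert w S)))
  -- (CAY-RAY): the `|D_w|^{1∕2}`-normalised split-chart functional along the `x`-ray `cay + x • e_{w,0}` (★ (V1-G′)'s token), `x → 0⁺`
  {Λ : ℂ} (hray : Tendsto (fun x : ℝ => ((|Real.exp x - Real.exp (-x)| : ℝ) : ℂ) *
      chartOrbG L α ν' (insert w S) a' (hcCayPt w 0 2 p + x • (Pi.single w (Pi.single 0 1 : Fin 3 → ℝ) : {w : InfinitePlace L // IsComplex w} → Fin 3 → ℝ)))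
    (𝓝[>] (0 : ℝ)) (𝓝 Λ))

include hS hwsp hray in
/-- **THE RAW SPLIT-CHART MEMBER ALONG THE `x`-RAY TENDS TO `C(cay) · Λ`** if the normalised functional tends to `Λ` along the ray (`C` the continuous cofactor of §1: on the
admissible label `orbFamG (S∪w) (ray x) = C(ray x) · (|e^{x} − e^{−x}| · chartOrbG (S∪w) a′ (ray x))`, ★ `cayRay_apply_self_zero`, ★ `tendsto_cayRay`).
[cite: Shelstad1979, §4 p. 22; Lemma 4.3 (p. 25)] [cite: Varadarajan1977, I §1.12] -/
theorem tendsto_orbFamG_cayRay_of_tendsto {C : ({w : InfinitePlace L // IsComplex w} → Fin 3 → ℝ) → ℂ} (hC : Continuous C)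
    (hfac : ∀ c, archRG (insert w S) c = ((|Real.exp (c w 0) - Real.exp (-c w 0)| : ℝ) : ℂ) * C c) :
    Tendsto (fun x : ℝ => orbFamG L α ν' a' (insert w S)
        (hcCayPt w 0 2 p + x • (Pi.single w (Pi.single 0 1 : Fin 3 → ℝ) : {w : InfinitePlace L // IsComplex w} → Fin 3 → ℝ)))
      (𝓝[>] (0 : ℝ)) (𝓝 (C (hcCayPt w 0 2 p) * Λ)) := by
  have hadm := insert_subset_splitChartPlaces L α hS hwsp
  have hCt : Tendsto (fun x : ℝ => C (hcCayPt w 0 2 p + x • (Pi.single w (Pi.single 0 1 : Fin 3 → ℝ) : {w : InfinitePlace L // IsComplex w} → Fin 3 → ℝ)))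
      (𝓝[>] (0 : ℝ)) (𝓝 (C (hcCayPt w 0 2 p))) :=
    (((hC.tendsto _).comp (tendsto_cayRay p w 0 2)).mono_left nhdsWithin_le_nhds)
  refine (hCt.mul hray).congr' (Eventually.of_forall fun x => ?_)
  show C _ * (((|Real.exp x - Real.exp (-x)| : ℝ) : ℂ) * chartOrbG L α ν' (insert w S) a' _) = orbFamG L α ν' a' (insert w S) _
  rw [orbFamG_apply L α ν' a' hadm, hfac, cayRay_apply_self_zero]
  ring

include hS hwsp hp hsm hray in
/-- **THE CAYLEY VALUE READ ALONG THE RAY**: under (I₁)+(I₂) on the split chart, `orbFamGExt ν′ a′ (S∪w) (cay) = C(cay) · Λ` (★ (V1-G′) `orbFamGExt_insert_hcCayPt_eq_of_tendsto_cayRay`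
on `tendsto_orbFamG_cayRay_of_tendsto`). [cite: Varadarajan1977, I §1.12] [cite: Shelstad1979, Lemma 4.3 (p. 25)] [cite: Bouaziz1994IntegralesOrbitales, §3.1 (I₂) p. 579] -/
theorem orbFamGExt_insert_hcCayPt_eq_mul_of_tendsto_cayRay {C : ({w : InfinitePlace L // IsComplex w} → Fin 3 → ℝ) → ℂ} (hC : Continuous C)
    (hfac : ∀ c, archRG (insert w S) c = ((|Real.exp (c w 0) - Real.exp (-c w 0)| : ℝ) : ℂ) * C c) :
    orbFamGExt L α ν' a' (insert w S) (hcCayPt w 0 2 p) = C (hcCayPt w 0 2 p) * Λ :=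
  orbFamGExt_insert_hcCayPt_eq_of_tendsto_cayRay L α ν' a' hsm hp (tendsto_orbFamG_cayRay_of_tendsto L α ν' a' hS hwsp hray hC hfac)

include hS hwsp hp hsm hray in
/-- **RAY-TO-FULL UPGRADE: §3's binder `hlim` from (I₁)+(I₂) and the `x`-ray limit.**  Under `hsm`, the `|D_w|^{1∕2}`-normalised split-chart functional
`c ↦ |e^{x_w(c)} − e^{−x_w(c)}| · chartOrbG (S∪w) a′ c` has the FULL limit `Λ` along `RegG (S∪w) ∋ c → cay`: on `RegG` it is `orbFamG (S∪w) c ∕ C(c)` (`C` continuous, `C(cay) ≠ 0`,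
§1), `orbFamG (S∪w) → orbFamGExt … (cay)` there (★ (V1-G′) `tendsto_orbFamG_nhdsWithin_regG_hcCayPt`), and that value is `C(cay) · Λ` (read along the ray).
[cite: Varadarajan1977, I §1.12] [cite: Shelstad1979, Lemma 4.3 (p. 25); Prop. 4.5 (p. 26)] -/
theorem tendsto_absSub_mul_chartOrbG_nhdsWithin_regG_of_tendsto_cayRay :
    Tendsto (fun c => ((|Real.exp (c w 0) - Real.exp (-c w 0)| : ℝ) : ℂ) * chartOrbG L α ν' (insert w S) a' c)
      (𝓝[RegG (insert w S)] (hcCayPt w 0 2 p)) (𝓝 Λ) := by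
  have hadm := insert_subset_splitChartPlaces L α hS hwsp
  obtain ⟨C, hC, hfac, -, hC0⟩ := exists_splitCofactor_insert S hp
  -- the raw member tends to the extended value `V = C(cay) · Λ` along `RegG`
  have hV := tendsto_orbFamG_nhdsWithin_regG_hcCayPt L α ν' a' hsm hp
  rw [orbFamGExt_insert_hcCayPt_eq_mul_of_tendsto_cayRay L α ν' a' hS hwsp hp hsm hray hC hfac] at hV
  -- divide by the continuous non-vanishing cofactor
  have hCt : Tendsto C (𝓝[RegG (insert w S)] (hcCayPt w 0 2 p)) (𝓝 (C (hcCayPt w 0 2 p))) :=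
    (hC.tendsto _).mono_left nhdsWithin_le_nhds
  have hne : ∀ᶠ c in 𝓝[RegG (insert w S)] (hcCayPt w 0 2 p), C c ≠ 0 :=
    (hC.continuousAt.eventually_ne hC0).filter_mono nhdsWithin_le_nhds
  have hlim : Tendsto (fun c => orbFamG L α ν' a' (insert w S) c * (C c)⁻¹) (𝓝[RegG (insert w S)] (hcCayPt w 0 2 p))
      (𝓝 (C (hcCayPt w 0 2 p) * Λ * (C (hcCayPt w 0 2 p))⁻¹)) := hV.mul (hCt.inv₀ hC0)
  rw [show C (hcCayPt w 0 2 p) * Λ * (C (hcCayPt w 0 2 p))⁻¹ = Λ by rw [mul_comm (C _) Λ, mul_inv_cancel_right₀ hC0]] at hlim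
  refine hlim.congr' (hne.mono fun c hc => ?_)
  show orbFamG L α ν' a' (insert w S) c * (C c)⁻¹ = ((|Real.exp (c w 0) - Real.exp (-c w 0)| : ℝ) : ℂ) * chartOrbG L α ν' (insert w S) a' c
  rw [orbFamG_apply L α ν' a' hadm, hfac c]
  field_simp

include hS hwsp hp hsm hray in
/-- **(JG′) FOR ONE TEST FUNCTION, READ BY CONTINUITY FROM THE `x`-RAY.**  §3's head with its full-neighbourhood binder `hlim` REPLACED by the membership's smooth clause `hsm` on the
split chart ((I₁)+(I₂), the joiner's RULINGS #7 antecedent) and the one-variable ray limit `hray` of the normalised split functional ((A0-c) at the fixed block function): at a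
semiregular point of the covered wall `(w, 0, 2)`, from (DESC) `hdesc`, (K0) `hjump`, (CAY-RAY) `hray`, (NONDEG) `Λ ≠ 0`, (BOOK-G′) `cG · Λ = i·K·J_b` — the twisted extended member
jumps by `cG · (e^{ρ}_{S∪w}(cay) · orbFamGExt ν′ a′ (S∪w)(cay))` and the Cayley value is non-zero.
[cite: Shelstad1979, Prop. 4.5 (p. 26); Thm. 4.7 (IIIb) (p. 31)] [cite: Rogawski1990, §8.2 pp. 119–124] [cite: Bouaziz1994IntegralesOrbitales, §3.2 (I₃) p. 580] [cite: Varadarajan1977, I §1.12] -/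
theorem hasOneSidedJump_orbFamGExt_side_of_bricks_of_cayRay (hw : w ∉ S)
    {K : ℂ} {Φ : ℝ → ℂ} (hdesc : ∀ᶠ ν in 𝓝[≠] (0 : ℝ), chartOrbG L α ν' S a' (p + ν • hcNrm w 0 2) = K * Φ ν)
    {Jb : ℂ} (hjump : HasOneSidedJump (fun ν : ℝ => (2 * Real.sin ν : ℂ) * Φ ν) Jb)
    (hΛ : Λ ≠ 0) {cG : ℂ} (hcG : cG * Λ = I * (K * Jb)) :
    HasOneSidedJump (fun ν : ℝ => archERhoG S (p + ν • hcNrm w 0 2) * orbFamGExt L α ν' a' S (p + ν • hcNrm w 0 2))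
        (cG * (archERhoG (insert w S) (hcCayPt w 0 2 p) * orbFamGExt L α ν' a' (insert w S) (hcCayPt w 0 2 p))) ∧
      orbFamGExt L α ν' a' (insert w S) (hcCayPt w 0 2 p) ≠ 0 :=
  hasOneSidedJump_orbFamGExt_side_of_bricks L α ν' a' hS hw hwsp hp hdesc hjump
    (tendsto_absSub_mul_chartOrbG_nhdsWithin_regG_of_tendsto_cayRay L α ν' a' hS hwsp hp hsm hray) hΛ hcG

include hS hwsp hp hsm hray in
/-- **(JG′) FROM THE RAY, EXPLICIT CONSTANT** (`J_b = C₁·cone`, `Λ = K_β·C₂·cone`, `cone ≠ 0`, `K_β ≠ 0`, `C₂ ≠ 0` ⇒ `cG = i·K·C₁∕(K_β·C₂)`).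
[cite: Shelstad1979, Prop. 4.5 (p. 26)] [cite: Rogawski1990, §8.2 Prop. 8.2.1 (c) p. 119; p. 122] -/
theorem hasOneSidedJump_orbFamGExt_side_of_bricks_of_cayRay_explicit (hw : w ∉ S)
    {K : ℂ} {Φ : ℝ → ℂ} (hdesc : ∀ᶠ ν in 𝓝[≠] (0 : ℝ), chartOrbG L α ν' S a' (p + ν • hcNrm w 0 2) = K * Φ ν)
    {Jb : ℂ} (hjump : HasOneSidedJump (fun ν : ℝ => (2 * Real.sin ν : ℂ) * Φ ν) Jb)
    {C₁ C₂ Kβ cone : ℂ} (hJb : Jb = C₁ * cone) (hΛ : Λ = Kβ * (C₂ * cone)) (hcone : cone ≠ 0) (hKβ : Kβ ≠ 0) (hC₂ : C₂ ≠ 0) :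
    HasOneSidedJump (fun ν : ℝ => archERhoG S (p + ν • hcNrm w 0 2) * orbFamGExt L α ν' a' S (p + ν • hcNrm w 0 2))
        ((I * (K * C₁) / (Kβ * C₂)) * (archERhoG (insert w S) (hcCayPt w 0 2 p) * orbFamGExt L α ν' a' (insert w S) (hcCayPt w 0 2 p))) ∧
      orbFamGExt L α ν' a' (insert w S) (hcCayPt w 0 2 p) ≠ 0 :=
  hasOneSidedJump_orbFamGExt_side_of_bricks_explicit L α ν' a' hS hw hwsp hp hdesc hjump
    (tendsto_absSub_mul_chartOrbG_nhdsWithin_regG_of_tendsto_cayRay L α ν' a' hS hwsp hp hsm hray) hJb hΛ hcone hKβ hC₂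

end Ray

/-! ## §5 (ED. 3) (c-jump): the (K0) binder `hjump` FROM THE SHARED RANK-ONE DATUM, for a block function ON THE GROUP, in the (A0) cone token

LH3-plan (g3) RULINGS #8∕#9 (2026-09-02T08:12Z∕08:16Z): the rank-one jump constant is read on the STANDARD group `U(J)`, `hJ : J = (StdForm.antidiagonal 2).over ℂ`, with ONE shared
Haar `μ₀` and ONE shared real `C₁` whose defining property — ★ p850353's conclusion for `(μ₀, C₁)`, all `f ∈ C_c(M₂(ℂ))`, all `z ∈ S¹` (LH4-p03 (g4)'s `SharedK0` text) — enters
as the ANTECEDENT `hK0`; after (B-STD) (F0P3a-p07 (g16)) the `G′`-block IS `U(J)` with `νB := μ₀`, so §3's `hjump` is `hK0` read for the descended block function `F = fB` ON THE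
GROUP (through any `C_c` extension `f`, ★ `exists_continuous_hasCompactSupport_extend`) at `z := e^{iθ}`, with the torus point `P·diag(e^{iθ}e^{iψ}, e^{iθ}e^{−iψ})·P⁻¹` and the
jump `C₁ · (cone⁺ + cone⁻)(f, e^{iθ})` written in the `Complex.exp (θ·I)` token of the (A0) datum `SharedA0` (so that §3∕§4's `hJb` and `hΛ` name ONE `cone` term). -/

section SharedK0

open Literature.NumberTheory.Automorphic.Shelstad1979.StableOrbitalIntegrals

variable {J : Matrix (Fin 2) (Fin 2) ℂ} (hJ : J = (StdForm.antidiagonal 2).over ℂ)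
  [MeasurableSpace ↥(unitaryGroupOfForm (starRingEnd ℂ) J)]
  (μ₀ : Measure ↥(unitaryGroupOfForm (starRingEnd ℂ) J)) {C₁ : ℝ}

/-- **(c-jump) `hjump` FROM THE SHARED (K0±) DATUM.**  If `(μ₀, C₁)` satisfies the shared (K0±) text `hK0` (★ p850353's conclusion: for every `f ∈ C_c(M₂(ℂ))` and `z ∈ S¹` the
Weyl-normalised elliptic orbital integral over `U(J)` at the Cayley torus point `P·diag(z e^{iψ}, z e^{−iψ})·P⁻¹` jumps by `C₁·(cone⁺ + cone⁻)(f, z)`), then for every block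
function `F` ON THE GROUP with a `C_c` extension `f` (`f ↑↑g = F g`) and every `θ`, `ψ ↦ 2 sin ψ · ∫_{U(J)} F(h·⟨P·diag(e^{iθ}e^{iψ}, e^{iθ}e^{−iψ})·P⁻¹,_⟩·h⁻¹) dμ₀` jumps by
`C₁·(cone⁺ + cone⁻)(f, e^{iθ})` — the cone in the `Complex.exp (θ·I)` token of the (A0) datum (`↑(Circle.exp θ) = Complex.exp (θ·I)`, ★ `Circle.coe_exp`).
[cite: Shelstad1979, Lemma 4.3 (p. 25)] [cite: Rogawski1990, §8.2 pp. 119, 122] -/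
theorem hasOneSidedJump_two_sin_mul_integral_block_of_sharedK0
    (hK0 : ∀ (f : Matrix (Fin 2) (Fin 2) ℂ → ℂ), Continuous f → HasCompactSupport f → ∀ z : Circle,
        HasOneSidedJump (fun ψ : ℝ => (2 * Real.sin ψ : ℂ) *
            ∫ h : ↥(unitaryGroupOfForm (starRingEnd ℂ) J),
              f (((h * ⟨Matrix.GeneralLinearGroup.mkOfDetNeZero !![(1 : ℂ), 1; 1, -1] det_cayleyTwo_ne_zero *
                    circleDiagonal 2 ![z * Circle.exp ψ, z * Circle.exp (-ψ)] *
                    (Matrix.GeneralLinearGroup.mkOfDetNeZero !![(1 : ℂ), 1; 1, -1] det_cayleyTwo_ne_zero)⁻¹,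
                  cayley_conj_circleDiagonal_mem_of_eq_over hJ _⟩ * h⁻¹ :
                ↥(unitaryGroupOfForm (starRingEnd ℂ) J)) : GL (Fin 2) ℂ) : Matrix (Fin 2) (Fin 2) ℂ) ∂μ₀)
          ((C₁ : ℂ) * ((∫ p in Ioi (0 : ℝ) ×ˢ Ioc (0 : ℝ) (2 * π),
              f ((!![(1 : ℂ), 1; 1, -1] : Matrix (Fin 2) (Fin 2) ℂ) *
                ((z : ℂ) • (1 : Matrix (Fin 2) (Fin 2) ℂ) + p.1 • Matrix.diagonal ![(z : ℂ) * I, -((z : ℂ) * I)] +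
                  p.1 • !![(0 : ℂ), -((z : ℂ) * I) * cexp (-((p.2 : ℂ) * I)); ((z : ℂ) * I) * cexp ((p.2 : ℂ) * I), 0]) *
                !![(1 / 2 : ℂ), 1 / 2; 1 / 2, -(1 / 2)])) +
            ∫ p in Ioi (0 : ℝ) ×ˢ Ioc (0 : ℝ) (2 * π),
              f ((!![(1 : ℂ), 1; 1, -1] : Matrix (Fin 2) (Fin 2) ℂ) *
                ((z : ℂ) • (1 : Matrix (Fin 2) (Fin 2) ℂ) + p.1 • Matrix.diagonal ![-((z : ℂ) * I), (z : ℂ) * I] +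
                  p.1 • !![(0 : ℂ), ((z : ℂ) * I) * cexp (-((p.2 : ℂ) * I)); -((z : ℂ) * I) * cexp ((p.2 : ℂ) * I), 0]) *
                !![(1 / 2 : ℂ), 1 / 2; 1 / 2, -(1 / 2)]))))
    (F : ↥(unitaryGroupOfForm (starRingEnd ℂ) J) → ℂ) (f : Matrix (Fin 2) (Fin 2) ℂ → ℂ) (hf : Continuous f) (hfc : HasCompactSupport f)
    (hfF : ∀ g : ↥(unitaryGroupOfForm (starRingEnd ℂ) J), f ((g : GL (Fin 2) ℂ) : Matrix (Fin 2) (Fin 2) ℂ) = F g) (θ : ℝ) :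
    HasOneSidedJump (fun ψ : ℝ => (2 * Real.sin ψ : ℂ) *
        ∫ h : ↥(unitaryGroupOfForm (starRingEnd ℂ) J),
          F (h * ⟨Matrix.GeneralLinearGroup.mkOfDetNeZero !![(1 : ℂ), 1; 1, -1] det_cayleyTwo_ne_zero *
                circleDiagonal 2 ![Circle.exp θ * Circle.exp ψ, Circle.exp θ * Circle.exp (-ψ)] *
                (Matrix.GeneralLinearGroup.mkOfDetNeZero !![(1 : ℂ), 1; 1, -1] det_cayleyTwo_ne_zero)⁻¹,
              cayley_conj_circleDiagonal_mem_of_eq_over hJ _⟩ * h⁻¹) ∂μ₀)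
      ((C₁ : ℂ) * ((∫ p in Ioi (0 : ℝ) ×ˢ Ioc (0 : ℝ) (2 * π),
          f ((!![(1 : ℂ), 1; 1, -1] : Matrix (Fin 2) (Fin 2) ℂ) *
            (Complex.exp ((θ : ℂ) * Complex.I) • (1 : Matrix (Fin 2) (Fin 2) ℂ) +
              p.1 • Matrix.diagonal ![Complex.exp ((θ : ℂ) * Complex.I) * Complex.I, -(Complex.exp ((θ : ℂ) * Complex.I) * Complex.I)] +
              p.1 • !![(0 : ℂ), -(Complex.exp ((θ : ℂ) * Complex.I) * Complex.I) * Complex.exp (-((p.2 : ℂ) * Complex.I));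
                (Complex.exp ((θ : ℂ) * Complex.I) * Complex.I) * Complex.exp ((p.2 : ℂ) * Complex.I), 0]) *
            !![(1 / 2 : ℂ), 1 / 2; 1 / 2, -(1 / 2)])) +
        ∫ p in Ioi (0 : ℝ) ×ˢ Ioc (0 : ℝ) (2 * π),
          f ((!![(1 : ℂ), 1; 1, -1] : Matrix (Fin 2) (Fin 2) ℂ) *
            (Complex.exp ((θ : ℂ) * Complex.I) • (1 : Matrix (Fin 2) (Fin 2) ℂ) +
              p.1 • Matrix.diagonal ![-(Complex.exp ((θ : ℂ) * Complex.I) * Complex.I), Complex.exp ((θ : ℂ) * Complex.I) * Complex.I] +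
              p.1 • !![(0 : ℂ), (Complex.exp ((θ : ℂ) * Complex.I) * Complex.I) * Complex.exp (-((p.2 : ℂ) * Complex.I));
                -(Complex.exp ((θ : ℂ) * Complex.I) * Complex.I) * Complex.exp ((p.2 : ℂ) * Complex.I), 0]) *
            !![(1 / 2 : ℂ), 1 / 2; 1 / 2, -(1 / 2)]))) := by
  have key := hK0 f hf hfc (Circle.exp θ)
  have hfun : (fun ψ : ℝ => (2 * Real.sin ψ : ℂ) *
      ∫ h : ↥(unitaryGroupOfForm (starRingEnd ℂ) J),
        F (h * ⟨Matrix.GeneralLinearGroup.mkOfDetNeZero !![(1 : ℂ), 1; 1, -1] det_cayleyTwo_ne_zero *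
              circleDiagonal 2 ![Circle.exp θ * Circle.exp ψ, Circle.exp θ * Circle.exp (-ψ)] *
              (Matrix.GeneralLinearGroup.mkOfDetNeZero !![(1 : ℂ), 1; 1, -1] det_cayleyTwo_ne_zero)⁻¹,
            cayley_conj_circleDiagonal_mem_of_eq_over hJ _⟩ * h⁻¹) ∂μ₀) =
      (fun ψ : ℝ => (2 * Real.sin ψ : ℂ) *
        ∫ h : ↥(unitaryGroupOfForm (starRingEnd ℂ) J),
          f (((h * ⟨Matrix.GeneralLinearGroup.mkOfDetNeZero !![(1 : ℂ), 1; 1, -1] det_cayleyTwo_ne_zero *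
                circleDiagonal 2 ![Circle.exp θ * Circle.exp ψ, Circle.exp θ * Circle.exp (-ψ)] *
                (Matrix.GeneralLinearGroup.mkOfDetNeZero !![(1 : ℂ), 1; 1, -1] det_cayleyTwo_ne_zero)⁻¹,
              cayley_conj_circleDiagonal_mem_of_eq_over hJ _⟩ * h⁻¹ :
            ↥(unitaryGroupOfForm (starRingEnd ℂ) J)) : GL (Fin 2) ℂ) : Matrix (Fin 2) (Fin 2) ℂ) ∂μ₀) := by
    funext ψ
    congr 1
    exact integral_congr_ae (Eventually.of_forall fun h => (hfF _).symm)
  rw [hfun]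
  exact key

end SharedK0

/-! ## §6 (ED. 3) The (JG′) conjunct WITH THE SHARED LITERAL `bookG = i·C₁∕C₂` (RULINGS #8 (ii)∕(iv)): the shape ★ `jumpBricks_of_sides_std`'s `hG` binds

With (B-STD) the block Haar IS the shared `μ₀` (`C₁ᴳ = C₁`), the Cayley limit is read against the shared `(μ₀′, C₂)` (`C₂ᴳ = C₂`), and (G′-CANCEL) (LH3-p03 (g4)) gives ONE
descent constant on both charts (`K_β = K`); then `hJb : J_b = C₁·cone`, `hΛ : Λ = K·(C₂·cone)` with the SAME `cone` (§5's (A0) token), `cone ≠ 0` ((NONDEG-G′) ★ p850462 §4),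
`K ≠ 0`, `C₂ ≠ 0` give the jump constant LITERALLY `(I * C₁ / C₂ : ℂ)` — `C₁ C₂ : ℝ` coerced, the token of ★ p850463 `jumpBricks_of_sides_std`. -/

section Std

open scoped ContDiff

variable (L : Type) [Field L] [NumberField L] [IsCMField L] (α : Fin 3 → L)
  [MeasurableSpace ↥(arch (↥(maximalRealSubfield L)) L (IsCMField.complexConj L) 3 (Matrix.diagonal α))] [BorelSpace ↥(arch (↥(maximalRealSubfield L)) L (IsCMField.complexConj L) 3 (Matrix.diagonal α))]
  (ν' : Measure ↥(arch (↥(maximalRealSubfield L)) L (IsCMField.complexConj L) 3 (Matrix.diagonal α))) [IsFiniteMeasureOnCompacts ν'] [ν'.IsMulRightInvariant]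
  (a' : ↥(arch (↥(maximalRealSubfield L)) L (IsCMField.complexConj L) 3 (Matrix.diagonal α)) → ℂ)
  {S : Finset {w : InfinitePlace L // IsComplex w}} (hS : ∀ v, v ∈ S → v ∈ splitChartPlaces L α)
  {w : {w : InfinitePlace L // IsComplex w}} (hw : w ∉ S) (hwsp : w ∈ splitChartPlaces L α)
  {p : {w : InfinitePlace L // IsComplex w} → Fin 3 → ℝ} (hp : HcSemireg S w 0 2 p)
  {K : ℂ} {Φ : ℝ → ℂ} (hdesc : ∀ᶠ ν in 𝓝[≠] (0 : ℝ), chartOrbG L α ν' S a' (p + ν • hcNrm w 0 2) = K * Φ ν)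
  {Jb : ℂ} (hjump : HasOneSidedJump (fun ν : ℝ => (2 * Real.sin ν : ℂ) * Φ ν) Jb)
  {C₁ C₂ : ℝ} {cone Λ : ℂ} (hJb : Jb = (C₁ : ℂ) * cone) (hΛ : Λ = K * ((C₂ : ℂ) * cone)) (hcone : cone ≠ 0) (hK : K ≠ 0) (hC₂ : C₂ ≠ 0)

include hJb hΛ hcone hK hC₂ in
/-- The bookkeeping of the shared literal: `(i·C₁∕C₂) · Λ = i·K·J_b` when `J_b = C₁·cone`, `Λ = K·(C₂·cone)`. [cite: Shelstad1979, Prop. 4.5 (p. 26)] -/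
theorem sharedLiteral_mul_eq : (I * C₁ / C₂ : ℂ) * Λ = I * (K * Jb) := by
  have hC₂' : (C₂ : ℂ) ≠ 0 := Complex.ofReal_ne_zero.2 hC₂
  rw [hΛ, hJb]
  field_simp

include hΛ hcone hK hC₂ in
/-- `Λ = K·(C₂·cone) ≠ 0`. [cite: Shelstad1979, Prop. 4.5 (p. 26)] -/
theorem sharedLiteral_lambda_ne_zero : Λ ≠ 0 := by
  rw [hΛ]
  exact mul_ne_zero hK (mul_ne_zero (Complex.ofReal_ne_zero.2 hC₂) hcone)

include hS hw hwsp hp hdesc hjump hJb hΛ hcone hK hC₂ in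
/-- **(JG′) FOR ONE TEST FUNCTION WITH THE SHARED LITERAL** (§3's head, full-neighbourhood binder `hlim`): jump constant `(I * C₁ / C₂ : ℂ)` — EXACTLY the `hG` text of
★ `jumpBricks_of_sides_std` for this `a′`. [cite: Shelstad1979, Prop. 4.5 (p. 26); Thm. 4.7 (IIIb) (p. 31)] [cite: Rogawski1990, §8.2 Prop. 8.2.1 (c) p. 119; p. 122] -/
theorem hasOneSidedJump_orbFamGExt_side_of_bricks_std
    (hlim : Tendsto (fun c => ((|Real.exp (c w 0) - Real.exp (-c w 0)| : ℝ) : ℂ) * chartOrbG L α ν' (insert w S) a' c)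
      (𝓝[RegG (insert w S)] (hcCayPt w 0 2 p)) (𝓝 Λ)) :
    HasOneSidedJump (fun ν : ℝ => archERhoG S (p + ν • hcNrm w 0 2) * orbFamGExt L α ν' a' S (p + ν • hcNrm w 0 2))
        ((I * C₁ / C₂ : ℂ) * (archERhoG (insert w S) (hcCayPt w 0 2 p) * orbFamGExt L α ν' a' (insert w S) (hcCayPt w 0 2 p))) ∧
      orbFamGExt L α ν' a' (insert w S) (hcCayPt w 0 2 p) ≠ 0 :=
  hasOneSidedJump_orbFamGExt_side_of_bricks L α ν' a' hS hw hwsp hp hdesc hjump hlim (sharedLiteral_lambda_ne_zero hΛ hcone hK hC₂)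
    (sharedLiteral_mul_eq hJb hΛ hcone hK hC₂)

include hS hw hwsp hp hdesc hjump hJb hΛ hcone hK hC₂ in
/-- **(JG′) FOR ONE TEST FUNCTION WITH THE SHARED LITERAL, READ FROM THE `x`-RAY** (§4's head: the membership's smooth clause `hsm` on the split chart + the one-variable ray
limit `hray`): jump constant `(I * C₁ / C₂ : ℂ)`. [cite: Shelstad1979, Prop. 4.5 (p. 26); Thm. 4.7 (IIIb) (p. 31)] [cite: Rogawski1990, §8.2 Prop. 8.2.1 (c) p. 119] [cite: Varadarajan1977, I §1.12] -/
theorem hasOneSidedJump_orbFamGExt_side_of_bricks_of_cayRay_std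
    (hsm : ContDiffOn ℝ ∞ (orbFamGExt L α ν' a' (insert w S)) (InRegG (slotSign L α) (insert w S)))
    (hray : Tendsto (fun x : ℝ => ((|Real.exp x - Real.exp (-x)| : ℝ) : ℂ) *
        chartOrbG L α ν' (insert w S) a' (hcCayPt w 0 2 p + x • (Pi.single w (Pi.single 0 1 : Fin 3 → ℝ) : {w : InfinitePlace L // IsComplex w} → Fin 3 → ℝ)))
      (𝓝[>] (0 : ℝ)) (𝓝 Λ)) :
    HasOneSidedJump (fun ν : ℝ => archERhoG S (p + ν • hcNrm w 0 2) * orbFamGExt L α ν' a' S (p + ν • hcNrm w 0 2))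
        ((I * C₁ / C₂ : ℂ) * (archERhoG (insert w S) (hcCayPt w 0 2 p) * orbFamGExt L α ν' a' (insert w S) (hcCayPt w 0 2 p))) ∧
      orbFamGExt L α ν' a' (insert w S) (hcCayPt w 0 2 p) ≠ 0 :=
  hasOneSidedJump_orbFamGExt_side_of_bricks_of_cayRay L α ν' a' hS hwsp hp hsm hray hw hdesc hjump (sharedLiteral_lambda_ne_zero hΛ hcone hK hC₂)
    (sharedLiteral_mul_eq hJb hΛ hcone hK hC₂)

end Std

end Literature.NumberTheory.Rogawski1990

end
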